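import Literature.NumberTheory.LFunctions.ConreyIwaniec2002Corollary63Large
import Literature.NumberTheory.LFunctions.DedekindCloseZeroHypothesisWeak
import HarnessLib

/-!
# The Landau–Siegel door on the close-zero hypothesis `H_K(A, α)`, from Conrey–Iwaniec's Proposition 8.1 alone

Cell landau-siegel/ls-inputs, line `smoothed-mellin-large` (I6c). The tree's weak door
`lOne_lowerBound_of_dedekindCloseZero_weak` (`DedekindCloseZeroHypothesisWeak.lean`) reads
`H_K(A, α) ∧ Theorem 1.1-weak ⟹ L(1,χ) ≥ ¼ (log q)^{−(4A+19)}` for large odd `q`; with Corollary 6.3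
discharged in the large range (`ConreyIwaniec2002Corollary63Large.lean`:
`conreyIwaniec2002_theorem11_weak_of_proposition81`, `ConreyIwaniec2002.theorem11_weak_of_prop81_large`)
the Conrey–Iwaniec input of the door is the typed Proposition 8.1 ALONE (or its `_large` binder).
Everything here is a one-line composition of tree theorems.

«The programme SEARCHES and TYPES; no claim about Landau–Siegel zeros, Theorems 1–2 of
arXiv:2211.02515 or a repaired Margin232 until a kernel theorem says so.»

## References
* [ConreyIwaniec2002] B. Conrey, H. Iwaniec, Acta Arith. 103 (2002) 259–312, Theorem 1.1,
  Proposition 8.1.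
-/

noncomputable section

open scoped NumberField
open Complex

namespace Literature.NumberTheory.LFunctions

open ConreyIwaniec2002 NumberField

/-- **THE DOOR FROM THE TYPED PROPOSITION 8.1**: `H_K(A, α)` and `conreyIwaniec2002_proposition81` give
`L(1,χ) ≥ ¼ (log q)^{−(4A+19)}` for all large odd `q` (`−q` fundamental), `χ` the odd primitive
quadratic character mod `q`, `K` quadratic of discriminant `−q`.
[cite: ConreyIwaniec2002, Theorem 1.1 (1.21)] -/
theorem lOne_lowerBound_of_dedekindCloseZero_of_proposition81 {A α : ℝ} (hA : 0 ≤ A) (hα : 0 < α)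
    (hα1 : α ≤ 1) (h81 : conreyIwaniec2002_proposition81) (h : DedekindCloseZeroHypothesis A α) :
    ∃ q₀ : ℕ, ∀ (q : ℕ) [NeZero q], q₀ ≤ q → 4 < q → Odd q →
      ∀ χ : DirichletCharacter ℂ q, χ.IsPrimitive → χ.IsQuadratic → χ.Odd →
        ∀ (K : Type) [Field K] [NumberField K],
          Module.finrank ℚ K = 2 → NumberField.discr K = -(q : ℤ) →
            (1 / 4) * Real.log q ^ (-(4 * A + 19)) ≤ ‖χ.LFunction 1‖ :=
  lOne_lowerBound_of_dedekindCloseZero_weak hA hα hα1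
    (conreyIwaniec2002_theorem11_weak_of_proposition81 h81) h

/-- **THE DOOR FROM PROPOSITION 8.1 IN THE RANGE OF ITS PRINTED PROOF** (`q^65 ≤ T`,
`e^{(log q)²} ≤ T`; the inline `_large` binder of `ConreyIwaniec2002.prop91_large_of_prop81_large`):
same conclusion. [cite: ConreyIwaniec2002, Theorem 1.1 (1.21); §8 p. 18] -/
theorem ConreyIwaniec2002.lOne_lowerBound_of_dedekindCloseZero_of_prop81_large {A α : ℝ} (hA : 0 ≤ A)
    (hα : 0 < α) (hα1 : α ≤ 1)
    (h81 : ∃ C : ℝ, 0 < C ∧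
      ∀ (q : ℕ) [NeZero q], 4 < q → Odd q → ∀ χ : DirichletCharacter ℂ q,
        χ.IsPrimitive → χ.IsQuadratic → χ.Odd →
          ∀ (K : Type) [Field K] [NumberField K],
            Module.finrank ℚ K = 2 → NumberField.discr K = -(q : ℤ) →
              ∀ (ψ : ClassGroup (𝓞 K) →* ℂˣ) (T : ℝ) (S : Finset ℝ) (t' : ℝ → ℝ),
                (q : ℝ) ^ (65 : ℕ) ≤ T → Real.exp (Real.log q ^ (2 : ℕ)) ≤ T →
                  IsDyadicPointSet S T →
                  defectD K ψ q S t' ≤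
                    C * (T * Real.log q ^ (7 : ℕ) + T * calL χ T * Real.log T ^ (4 : ℕ)))
    (h : DedekindCloseZeroHypothesis A α) :
    ∃ q₀ : ℕ, ∀ (q : ℕ) [NeZero q], q₀ ≤ q → 4 < q → Odd q →
      ∀ χ : DirichletCharacter ℂ q, χ.IsPrimitive → χ.IsQuadratic → χ.Odd →
        ∀ (K : Type) [Field K] [NumberField K],
          Module.finrank ℚ K = 2 → NumberField.discr K = -(q : ℤ) →
            (1 / 4) * Real.log q ^ (-(4 * A + 19)) ≤ ‖χ.LFunction 1‖ :=
  lOne_lowerBound_of_dedekindCloseZero_weak hA hα hα1 (theorem11_weak_of_prop81_large h81) h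

end Literature.NumberTheory.LFunctions

end
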